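import Summits.AtomisticToContinuum.HydrodynamicLimit.Theorems.StiffCollisionalRelaxationAprioriBoundsFibrePartOneOfTailsA
import HarnessLib

/-!
# Component (i) of the a-priori crux from the two tail packages (stub `stub_partOne_of_tails`)

Supporting file of the line `fibre-deficit-transfer` for the crux `AprioriBounds`
(stmt-AtomisticToContinuum-14827; `StiffCollisionalRelaxation.AprioriBounds` =
`CollisionIsometryCLT.AprioriBoundsPreShock`), lead prover `prover-line-stmt-AtomisticToContinuum-14827-a1-0`.
It proves the registered stub 7, `stub_partOne_of_tails`: for `0 < σ ≤ 1/2`, nice profiles and `t > 0`,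

  `BulkTailAt σ a₀ θ₀ u₀ Φ t → FarTailAt σ a₀ θ₀ u₀ Φ t → PartOneAt σ a₀ θ₀ u₀ Φ t`,

i.e. sub-Maxwellian one-particle tails at every level with polynomial probability (`Θ, A, a`) plus a far-tail
occupation bound in the mean above `K₀ log(N+2)` (`Θ', A', r, K₀`) give component (i) of the crux VERBATIM:
`∃ λ > 0, C` with `P_N{C < ∫₀ᵗ (N+1)⁻¹∑ᵢ e^{λ|vᵢ(s)|²} ds} → 0`.  No dynamics is used beyond the hard-sphere-flow
axioms and energy conservation.

## Proof (layer cake + λ-dial + Markov/Tonelli)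

The particle-number-wise step is `partOne_markov_step` (file `…FibrePartOneOfTailsA.lean`): by the layer cake
`e^{λ|v|²} ≤ ∑_K e^{λ(K+1)}𝟙{K ≤ |v|²}`, on a good orbit `∫₀ᵗ (N+1)⁻¹∑ᵢe^{λ|vᵢ|²} ≤ ∑_K e^{λ(K+1)}∫₀ᵗ frac_K`; the
levels `K ≤ K_N := ⌊(a/2)log(N+1)/λ⌋` are controlled off the bad events of `BulkTailAt` by the thresholds
`thr_K = 2A⁺e^{−K/(2Θ)} + (N+1)^{−a}` (deterministic part `≤ t·C_λ + t(N+1)^{−a}∑_{K≤K_N}e^{λ(K+1)} ≤ t·C_λ + 1/2`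
eventually, `C_λ = 2A⁺e^{λ}/(1 − e^{−(1/(2Θ)−λ)})`), the bad events cost `≤ t(N+1)^{−a}∑_{K≤K_N}e^{λ(K+1)}
≤ t·c₁(N+1)^{−a/2}` in the mean, and the far levels `K > K_N ≥ K₀log(N+2) − 1` cost
`≤ tA'⁺e^{λ}(N+1)^{r}e^{−δ(K_N+1)}/(1 − e^{−δ}) ≤ c₂(N+1)^{r − δa/(2λ)}`, `δ = 1/(2Θ') − λ`.  THE DIAL
`λ := a/(4aΘ + 8Θ'(r⁺ + a/2) + 4K₀⁺ + 2)` makes `λ < 1/(2Θ)`, `r − δa/(2λ) < 0` and `4K₀⁺λ ≤ a`, so both error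
terms are negative powers of `N + 1` and Markov closes: `P_N(bad) ≤ 2(t·c₁(N+1)^{−a/2} + c₂(N+1)^{−q₂}) → 0` with
the FIXED threshold `C := t·C_λ + 1`.

No new definitions, no named facts; axioms `propext`, `Classical.choice`, `Quot.sound`.
-/

noncomputable section

open MeasureTheory Filter Set Topology
open scoped ENNReal

namespace Summit.AtomisticToContinuum.HydrodynamicLimit.Theorems.FibreDeficitTransfer

open Literature.MathematicalPhysics.KineticTheory Literature.Analysis.FluidPDE
open Summit.AtomisticToContinuum.HydrodynamicLimit.Theorems.AprioriBoundsNegative (PartOneAt PartTwoAt)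
open Summit.AtomisticToContinuum.HydrodynamicLimit.Theorems.VisitLedgerUpscattering (Cfg Flow Flows NiceProfiles)

/-! ## Real-analysis lemmas: geometric sums, the level cut `K_N = ⌊(a/2) log(N+1)/λ⌋`, decay -/

/-- `∑_{K<M} e^{λ(K+1)} ≤ e^{λ(M+1)}/(e^λ − 1)` for `λ > 0` (finite geometric sum). -/
theorem sum_range_exp_le {lam : ℝ} (hlam : 0 < lam) (M : ℕ) :
    ∑ K ∈ Finset.range M, Real.exp (lam * ((K : ℝ) + 1)) ≤
      Real.exp (lam * ((M : ℝ) + 1)) / (Real.exp lam - 1) := by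
  have h1 : 1 < Real.exp lam := Real.one_lt_exp_iff.2 hlam
  have hq : 0 < Real.exp lam - 1 := sub_pos.2 h1
  have hterm : ∀ K : ℕ, Real.exp (lam * ((K : ℝ) + 1)) = Real.exp lam ^ K * Real.exp lam := fun K => by
    rw [← Real.exp_nat_mul, ← Real.exp_add]
    congr 1
    ring
  calc ∑ K ∈ Finset.range M, Real.exp (lam * ((K : ℝ) + 1))
      = (∑ K ∈ Finset.range M, Real.exp lam ^ K) * Real.exp lam := by
        rw [Finset.sum_mul]
        exact Finset.sum_congr rfl fun K _ => hterm K
    _ = (Real.exp lam ^ M - 1) / (Real.exp lam - 1) * Real.exp lam := by rw [geom_sum_eq h1.ne']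
    _ ≤ Real.exp lam ^ M / (Real.exp lam - 1) * Real.exp lam :=
        mul_le_mul_of_nonneg_right (div_le_div_of_nonneg_right (by linarith) hq.le) (Real.exp_pos _).le
    _ = Real.exp (lam * ((M : ℝ) + 1)) / (Real.exp lam - 1) := by rw [hterm M]; ring

/-- `∑_{K<M} e^{λ(K+1)} e^{−K/(2Θ)} ≤ e^{λ}/(1 − e^{−(1/(2Θ) − λ)})` for `λ < 1/(2Θ)` (geometric series). -/
theorem sum_range_exp_mul_exp_neg_le {lam Θ : ℝ} (hδ : 0 < 1 / (2 * Θ) - lam) (M : ℕ) :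
    ∑ K ∈ Finset.range M, Real.exp (lam * ((K : ℝ) + 1)) * Real.exp (-((K : ℝ) / (2 * Θ))) ≤
      Real.exp lam / (1 - Real.exp (-(1 / (2 * Θ) - lam))) := by
  set q : ℝ := Real.exp (-(1 / (2 * Θ) - lam)) with hq
  have hq0 : 0 ≤ q := (Real.exp_pos _).le
  have hq1 : q < 1 := Real.exp_lt_one_iff.2 (by linarith)
  have hterm : ∀ K : ℕ, Real.exp (lam * ((K : ℝ) + 1)) * Real.exp (-((K : ℝ) / (2 * Θ))) =
      Real.exp lam * q ^ K := by
    intro K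
    rw [hq, ← Real.exp_nat_mul, ← Real.exp_add, ← Real.exp_add]
    congr 1
    ring
  have hsum : Summable fun K : ℕ => Real.exp lam * q ^ K := (summable_geometric_of_lt_one hq0 hq1).mul_left _
  calc ∑ K ∈ Finset.range M, Real.exp (lam * ((K : ℝ) + 1)) * Real.exp (-((K : ℝ) / (2 * Θ)))
      = ∑ K ∈ Finset.range M, Real.exp lam * q ^ K := Finset.sum_congr rfl fun K _ => hterm K
    _ ≤ ∑' K : ℕ, Real.exp lam * q ^ K := hsum.sum_le_tsum (Finset.range M) (fun K _ => by positivity)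
    _ = Real.exp lam / (1 - q) := by rw [tsum_mul_left, tsum_geometric_of_lt_one hq0 hq1, div_eq_mul_inv]

/-- The level cut: `e^{λ K_N} ≤ (N+1)^{a/2}` for `K_N = ⌊(a/2) log(N+1)/λ⌋`. -/
theorem exp_mul_levelCut_le {a lam : ℝ} (ha : 0 ≤ a) (hlam : 0 < lam) (N : ℕ) :
    Real.exp (lam * (⌊a / 2 * Real.log ((N : ℝ) + 1) / lam⌋₊ : ℝ)) ≤ ((N : ℝ) + 1) ^ (a / 2) := by
  have hN : (0 : ℝ) < (N : ℝ) + 1 := by positivity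
  have hlog : 0 ≤ Real.log ((N : ℝ) + 1) := Real.log_nonneg (by linarith)
  have harg : 0 ≤ a / 2 * Real.log ((N : ℝ) + 1) / lam := by positivity
  rw [Real.rpow_def_of_pos hN]
  refine Real.exp_le_exp.2 ?_
  calc lam * (⌊a / 2 * Real.log ((N : ℝ) + 1) / lam⌋₊ : ℝ)
      ≤ lam * (a / 2 * Real.log ((N : ℝ) + 1) / lam) := mul_le_mul_of_nonneg_left (Nat.floor_le harg) hlam.le
    _ = Real.log ((N : ℝ) + 1) * (a / 2) := by
        field_simp

/-- The level cut: `e^{−δ(K_N+1)} ≤ (N+1)^{−δa/(2λ)}` for `δ ≥ 0`. -/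
theorem exp_neg_mul_levelCut_succ_le {a lam δ : ℝ} (hlam : 0 < lam) (hδ : 0 ≤ δ) (N : ℕ) :
    Real.exp (-(δ * ((⌊a / 2 * Real.log ((N : ℝ) + 1) / lam⌋₊ : ℝ) + 1))) ≤
      ((N : ℝ) + 1) ^ (-(δ * a / (2 * lam))) := by
  have hN : (0 : ℝ) < (N : ℝ) + 1 := by positivity
  have hlt : a / 2 * Real.log ((N : ℝ) + 1) / lam < (⌊a / 2 * Real.log ((N : ℝ) + 1) / lam⌋₊ : ℝ) + 1 :=
    Nat.lt_floor_add_one _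
  rw [Real.rpow_def_of_pos hN]
  refine Real.exp_le_exp.2 ?_
  have h1 : δ * (a / 2 * Real.log ((N : ℝ) + 1) / lam) ≤ δ * ((⌊a / 2 * Real.log ((N : ℝ) + 1) / lam⌋₊ : ℝ) + 1) :=
    mul_le_mul_of_nonneg_left hlt.le hδ
  have h2 : δ * (a / 2 * Real.log ((N : ℝ) + 1) / lam) = Real.log ((N : ℝ) + 1) * (δ * a / (2 * lam)) := by
    field_simp
  linarith

/-- The level cut reaches the far tail: for `N ≥ 1` and `4K₀⁺λ ≤ a`, `K₀ log(N+2) ≤ K_N + 1`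
(`log(N+2) ≤ 2 log(N+1)`). -/
theorem levelCut_far {a lam K₀ : ℝ} (hlam : 0 < lam) (hK : 4 * max K₀ 0 * lam ≤ a) {N : ℕ} (hN : 1 ≤ N) :
    K₀ * Real.log ((N : ℝ) + 2) ≤ (⌊a / 2 * Real.log ((N : ℝ) + 1) / lam⌋₊ : ℝ) + 1 := by
  have hN1 : (1 : ℝ) ≤ N := by exact_mod_cast hN
  have hlog1 : 0 ≤ Real.log ((N : ℝ) + 1) := Real.log_nonneg (by linarith)
  have hlog2 : 0 ≤ Real.log ((N : ℝ) + 2) := Real.log_nonneg (by linarith)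
  have hlogle : Real.log ((N : ℝ) + 2) ≤ 2 * Real.log ((N : ℝ) + 1) := by
    have h := Real.log_le_log (by linarith : (0 : ℝ) < (N : ℝ) + 2)
      (show (N : ℝ) + 2 ≤ ((N : ℝ) + 1) ^ 2 by nlinarith)
    rwa [Real.log_pow, Nat.cast_ofNat] at h
  have hKp : K₀ ≤ max K₀ 0 := le_max_left _ _
  have hKp0 : 0 ≤ max K₀ 0 := le_max_right _ _
  have hlt := Nat.lt_floor_add_one (a / 2 * Real.log ((N : ℝ) + 1) / lam)
  have h3 : max K₀ 0 * (2 * Real.log ((N : ℝ) + 1)) ≤ a / 2 * Real.log ((N : ℝ) + 1) / lam := by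
    rw [le_div_iff₀ hlam]
    nlinarith [mul_le_mul_of_nonneg_right hK hlog1]
  calc K₀ * Real.log ((N : ℝ) + 2) ≤ max K₀ 0 * Real.log ((N : ℝ) + 2) :=
        mul_le_mul_of_nonneg_right hKp hlog2
    _ ≤ max K₀ 0 * (2 * Real.log ((N : ℝ) + 1)) := mul_le_mul_of_nonneg_left hlogle hKp0
    _ ≤ a / 2 * Real.log ((N : ℝ) + 1) / lam := h3
    _ ≤ (⌊a / 2 * Real.log ((N : ℝ) + 1) / lam⌋₊ : ℝ) + 1 := hlt.le

/-- Negative powers of `N + 1` tend to zero. -/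
theorem tendsto_rpow_neg_natCast_succ {q : ℝ} (hq : 0 < q) :
    Tendsto (fun N : ℕ => ((N : ℝ) + 1) ^ (-q)) atTop (𝓝 0) :=
  (tendsto_rpow_neg_atTop hq).comp (tendsto_atTop_add_const_right atTop 1 tendsto_natCast_atTop_atTop)

/-- The bulk error term decays: `(N+1)^{−a} ∑_{K ≤ K_N} e^{λ(K+1)} ≤ (e^{2λ}/(e^λ − 1)) (N+1)^{−a/2}`. -/
theorem slack_mul_sum_le {a lam : ℝ} (ha : 0 < a) (hlam : 0 < lam) (N : ℕ) :
    ((N : ℝ) + 1) ^ (-a) * ∑ K ∈ Finset.range (⌊a / 2 * Real.log ((N : ℝ) + 1) / lam⌋₊ + 1),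
        Real.exp (lam * ((K : ℝ) + 1)) ≤ Real.exp (2 * lam) / (Real.exp lam - 1) * ((N : ℝ) + 1) ^ (-(a / 2)) := by
  set KN : ℕ := ⌊a / 2 * Real.log ((N : ℝ) + 1) / lam⌋₊ with hKN
  have hN : (0 : ℝ) < (N : ℝ) + 1 := by positivity
  have hq : 0 < Real.exp lam - 1 := sub_pos.2 (Real.one_lt_exp_iff.2 hlam)
  have h1 := sum_range_exp_le hlam (KN + 1)
  have h2 : Real.exp (lam * (((KN + 1 : ℕ) : ℝ) + 1)) = Real.exp (lam * (KN : ℝ)) * Real.exp (2 * lam) := by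
    rw [← Real.exp_add]
    congr 1
    push_cast
    ring
  have h3 : Real.exp (lam * (KN : ℝ)) ≤ ((N : ℝ) + 1) ^ (a / 2) := exp_mul_levelCut_le ha.le hlam N
  have h4 : ∑ K ∈ Finset.range (KN + 1), Real.exp (lam * ((K : ℝ) + 1)) ≤
      ((N : ℝ) + 1) ^ (a / 2) * (Real.exp (2 * lam) / (Real.exp lam - 1)) := by
    calc ∑ K ∈ Finset.range (KN + 1), Real.exp (lam * ((K : ℝ) + 1)) ≤ _ := h1
      _ = Real.exp (lam * (KN : ℝ)) * (Real.exp (2 * lam) / (Real.exp lam - 1)) := by rw [h2, mul_div_assoc]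
      _ ≤ ((N : ℝ) + 1) ^ (a / 2) * (Real.exp (2 * lam) / (Real.exp lam - 1)) :=
          mul_le_mul_of_nonneg_right h3 (by positivity)
  have h5 : ((N : ℝ) + 1) ^ (-a) * ((N : ℝ) + 1) ^ (a / 2) = ((N : ℝ) + 1) ^ (-(a / 2)) := by
    rw [← Real.rpow_add hN]
    congr 1
    ring
  calc ((N : ℝ) + 1) ^ (-a) * ∑ K ∈ Finset.range (KN + 1), Real.exp (lam * ((K : ℝ) + 1))
      ≤ ((N : ℝ) + 1) ^ (-a) * (((N : ℝ) + 1) ^ (a / 2) * (Real.exp (2 * lam) / (Real.exp lam - 1))) :=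
        mul_le_mul_of_nonneg_left h4 (Real.rpow_nonneg hN.le _)
    _ = Real.exp (2 * lam) / (Real.exp lam - 1) * ((N : ℝ) + 1) ^ (-(a / 2)) := by
        rw [← mul_assoc, h5, mul_comm]

/-- The far error term decays: `X (N+1)^r e^{−δ(K_N+1)} ≤ X (N+1)^{−(δa/(2λ) − r)}` for `X, δ ≥ 0`. -/
theorem far_amplitude_le {a lam δ X : ℝ} (r : ℝ) (hlam : 0 < lam) (hδ : 0 ≤ δ) (hX : 0 ≤ X) (N : ℕ) :
    X * ((N : ℝ) + 1) ^ r * Real.exp (-(δ * ((⌊a / 2 * Real.log ((N : ℝ) + 1) / lam⌋₊ : ℝ) + 1))) ≤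
      X * ((N : ℝ) + 1) ^ (-(δ * a / (2 * lam) - r)) := by
  have hN : (0 : ℝ) < (N : ℝ) + 1 := by positivity
  have h1 := exp_neg_mul_levelCut_succ_le (a := a) hlam hδ N
  have e : ((N : ℝ) + 1) ^ (-(δ * a / (2 * lam) - r)) =
      ((N : ℝ) + 1) ^ r * ((N : ℝ) + 1) ^ (-(δ * a / (2 * lam))) := by
    rw [← Real.rpow_add hN]
    congr 1
    ring
  rw [e, ← mul_assoc]
  exact mul_le_mul_of_nonneg_left h1 (by positivity)

/-! ## The bound at one particle number -/

/-- **The bound at one (large) particle number.**  For nice profiles, `σ ≤ 1/2`, one flow `Φ` of `N + 1`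
spheres, a dialled `λ` (`λ < 1/(2Θ)`, `λ < 1/(2Θ')`, `4K₀⁺λ ≤ a`), `N ≥ 1`, the bulk tail bound at `N` (all
`s ≤ t`, all levels), the far-tail bound at `N` (levels `≥ K₀ log(N+2)`) and the smallness
`t(N+1)^{−a}∑_{K≤K_N}e^{λ(K+1)} ≤ 1/2`:
`P_N{t·C_λ + 1 < ∫₀ᵗ (N+1)⁻¹∑ᵢ e^{λ|vᵢ(s)|²} ds} ≤ 2(t(N+1)^{−a}∑_{K≤K_N}e^{λ(K+1)} + tA'⁺(N+1)^r e^{λ}e^{−δ(K_N+1)}/(1 − e^{−δ}))`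
(`partOne_markov_step` with `M = K_N + 1`, `thr_K = 2A⁺e^{−K/(2Θ)} + (N+1)^{−a}`, `p = (N+1)^{−a}`, `ρ = e^{−δ}`). -/
theorem partOne_bound_at {σ : ℝ} {a₀ θ₀ : T3 → ℝ} {u₀ : T3 → V3} (hP : NiceProfiles a₀ θ₀ u₀) (hσ2 : σ ≤ 1 / 2)
    {N : ℕ} (Φ : HardSphereFlow (Torus.geometry (Fin 3)) (hsDiameter σ N) (N + 1))
    {t lam Θ Θ' A A' a r K₀ : ℝ} (ht : 0 < t) (hlam : 0 < lam)
    (hδ₁ : 0 < 1 / (2 * Θ) - lam) (hδ : 0 < 1 / (2 * Θ') - lam) (hlamK : 4 * max K₀ 0 * lam ≤ a) (hN1 : 1 ≤ N)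
    (hbulk : ∀ s ∈ Icc 0 t, ∀ K : ℝ, localGibbsLaw σ a₀ u₀ θ₀ N Φ
      {z | 2 * A * Real.exp (-(K / (2 * Θ))) + ((N : ℝ) + 1) ^ (-a) < frac K (Φ.flow s z)} ≤
        ENNReal.ofReal (((N : ℝ) + 1) ^ (-a)))
    (hfar : ∀ K : ℝ, K₀ * Real.log ((N : ℝ) + 2) ≤ K →
      ∫⁻ z, (∫⁻ s in Icc 0 t, ENNReal.ofReal (frac K (Φ.flow s z))) ∂(localGibbsLaw σ a₀ u₀ θ₀ N Φ) ≤
        ENNReal.ofReal (t * A' * ((N : ℝ) + 1) ^ r * Real.exp (-(K / (2 * Θ')))))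
    (hhalf : t * (((N : ℝ) + 1) ^ (-a) *
      ∑ K ∈ Finset.range (⌊a / 2 * Real.log ((N : ℝ) + 1) / lam⌋₊ + 1), Real.exp (lam * ((K : ℝ) + 1))) ≤ 1 / 2) :
    localGibbsLaw σ a₀ u₀ θ₀ N Φ {z | t * (2 * max A 0 * (Real.exp lam / (1 - Real.exp (-(1 / (2 * Θ) - lam))))) + 1 <
        ∫ s in Icc 0 t, ∫ y, Real.exp (lam * ‖y.2‖ ^ 2) ∂(empiricalMeasure (Φ.flow s z))} ≤
      ENNReal.ofReal (2 * (t * (((N : ℝ) + 1) ^ (-a) *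
          ∑ K ∈ Finset.range (⌊a / 2 * Real.log ((N : ℝ) + 1) / lam⌋₊ + 1), Real.exp (lam * ((K : ℝ) + 1))) +
        t * max A' 0 * ((N : ℝ) + 1) ^ r * Real.exp lam *
            Real.exp (-((1 / (2 * Θ') - lam) * ((⌊a / 2 * Real.log ((N : ℝ) + 1) / lam⌋₊ : ℝ) + 1))) /
          (1 - Real.exp (-(1 / (2 * Θ') - lam))))) := by
  obtain ⟨ha₀, hθ, hu, ha0, hθ0⟩ := hP
  have hAp : A ≤ max A 0 := le_max_left _ _
  have hAp0 : 0 ≤ max A 0 := le_max_right _ _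
  have hAp' : A' ≤ max A' 0 := le_max_left _ _
  have hAp0' : 0 ≤ max A' 0 := le_max_right _ _
  set P : Measure (Cfg N) := localGibbsLaw σ a₀ u₀ θ₀ N Φ with hPdef
  have hprob : IsProbabilityMeasure P := isProbabilityMeasure_localGibbsLaw ha₀ hθ hu ha0 hθ0 hσ2 N Φ
  have hgood0 : P Φ.goodᶜ = 0 := by
    rw [hPdef, localGibbsLaw_eq]
    exact (localGibbsMeasure_absolutelyContinuous σ _ _ _ N Φ) Φ.measure_compl_good
  set KN : ℕ := ⌊a / 2 * Real.log ((N : ℝ) + 1) / lam⌋₊ with hKN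
  set p : ℝ := ((N : ℝ) + 1) ^ (-a) with hp
  have hp0 : 0 ≤ p := Real.rpow_nonneg (by positivity) _
  set S₁ : ℝ := ∑ K ∈ Finset.range (KN + 1), Real.exp (lam * ((K : ℝ) + 1)) with hS₁
  set δ : ℝ := 1 / (2 * Θ') - lam with hδ_def
  set ρ : ℝ := Real.exp (-δ) with hρ_def
  have hρ0 : 0 < ρ := Real.exp_pos _
  have hρ1 : ρ < 1 := Real.exp_lt_one_iff.2 (by linarith)
  set B : ℝ := t * max A' 0 * ((N : ℝ) + 1) ^ r * Real.exp lam * Real.exp (-(δ * ((KN : ℝ) + 1))) with hB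
  have hB0 : 0 ≤ B := by positivity
  set Cl : ℝ := 2 * max A 0 * (Real.exp lam / (1 - Real.exp (-(1 / (2 * Θ) - lam)))) with hCl
  have h1q : 0 < 1 - Real.exp (-(1 / (2 * Θ) - lam)) := sub_pos.2 (Real.exp_lt_one_iff.2 (by linarith))
  have hCl0 : 0 ≤ Cl := by positivity
  set thr : ℕ → ℝ := fun K => 2 * max A 0 * Real.exp (-((K : ℝ) / (2 * Θ))) + p with hthr
  have hthr0 : ∀ K, 0 ≤ thr K := fun K => by positivity
  -- (a) the deterministic bulk sum
  have hC : t * ∑ K ∈ Finset.range (KN + 1), Real.exp (lam * ((K : ℝ) + 1)) * thr K ≤ t * Cl + 1 / 2 := by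
    have hsplit : ∑ K ∈ Finset.range (KN + 1), Real.exp (lam * ((K : ℝ) + 1)) * thr K =
        2 * max A 0 * ∑ K ∈ Finset.range (KN + 1), Real.exp (lam * ((K : ℝ) + 1)) *
          Real.exp (-((K : ℝ) / (2 * Θ))) + p * S₁ := by
      rw [hS₁, Finset.mul_sum, Finset.mul_sum, ← Finset.sum_add_distrib]
      refine Finset.sum_congr rfl fun K _ => ?_
      simp only [hthr]
      ring
    have hgeo : 2 * max A 0 * ∑ K ∈ Finset.range (KN + 1), Real.exp (lam * ((K : ℝ) + 1)) *
        Real.exp (-((K : ℝ) / (2 * Θ))) ≤ Cl := by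
      rw [hCl]
      exact mul_le_mul_of_nonneg_left (sum_range_exp_mul_exp_neg_le hδ₁ _) (by positivity)
    rw [hsplit, mul_add]
    exact add_le_add (mul_le_mul_of_nonneg_left hgeo ht.le) hhalf
  -- (b) the bulk bad events
  have hbulk' : ∀ s ∈ Icc 0 t, ∀ K ∈ Finset.range (KN + 1),
      P {z | thr K < frac (K : ℝ) (Φ.flow s z)} ≤ ENNReal.ofReal p := by
    intro s hs K _
    refine (measure_mono fun z hz => ?_).trans (hbulk s hs (K : ℝ))
    have he : 0 ≤ Real.exp (-((K : ℝ) / (2 * Θ))) := (Real.exp_pos _).le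
    have hle : 2 * A * Real.exp (-((K : ℝ) / (2 * Θ))) + p ≤ thr K := by
      show 2 * A * Real.exp (-((K : ℝ) / (2 * Θ))) + p ≤ 2 * max A 0 * Real.exp (-((K : ℝ) / (2 * Θ))) + p
      exact add_le_add_left (mul_le_mul_of_nonneg_right (by linarith) he) _
    exact hle.trans_lt hz
  -- (c) the far levels
  have hfar' : ∀ j : ℕ, ENNReal.ofReal (Real.exp (lam * (((j + (KN + 1) : ℕ) : ℝ) + 1))) *
      ∫⁻ z, (∫⁻ s in Icc 0 t, ENNReal.ofReal (frac ((j + (KN + 1) : ℕ) : ℝ) (Φ.flow s z))) ∂P ≤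
      ENNReal.ofReal (B * ρ ^ j) := by
    intro j
    have hlev : K₀ * Real.log ((N : ℝ) + 2) ≤ ((j + (KN + 1) : ℕ) : ℝ) := by
      have h := levelCut_far (a := a) hlam hlamK hN1
      have hj : (0 : ℝ) ≤ j := Nat.cast_nonneg j
      push_cast
      linarith
    have h := hfar (((j + (KN + 1) : ℕ) : ℝ)) hlev
    set x : ℝ := ((j + (KN + 1) : ℕ) : ℝ) with hx
    have hY : 0 ≤ t * (((N : ℝ) + 1) ^ r * Real.exp (-(x / (2 * Θ')))) := by positivity
    have hmono : t * A' * ((N : ℝ) + 1) ^ r * Real.exp (-(x / (2 * Θ'))) ≤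
        t * max A' 0 * ((N : ℝ) + 1) ^ r * Real.exp (-(x / (2 * Θ'))) := by
      calc t * A' * ((N : ℝ) + 1) ^ r * Real.exp (-(x / (2 * Θ')))
          = A' * (t * (((N : ℝ) + 1) ^ r * Real.exp (-(x / (2 * Θ'))))) := by ring
        _ ≤ max A' 0 * (t * (((N : ℝ) + 1) ^ r * Real.exp (-(x / (2 * Θ'))))) :=
            mul_le_mul_of_nonneg_right hAp' hY
        _ = t * max A' 0 * ((N : ℝ) + 1) ^ r * Real.exp (-(x / (2 * Θ'))) := by ring
    have hxe : x = (j : ℝ) + ((KN : ℝ) + 1) := by rw [hx]; push_cast; ring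
    have ex : Real.exp (lam * (x + 1)) * Real.exp (-(x / (2 * Θ'))) =
        Real.exp lam * Real.exp (-(δ * ((KN : ℝ) + 1))) * Real.exp ((j : ℝ) * (-δ)) := by
      rw [← Real.exp_add, ← Real.exp_add, ← Real.exp_add, hxe, hδ_def]
      congr 1
      ring
    have halg : Real.exp (lam * (x + 1)) * (t * max A' 0 * ((N : ℝ) + 1) ^ r * Real.exp (-(x / (2 * Θ')))) =
        B * ρ ^ j := by
      rw [hB, hρ_def, ← Real.exp_nat_mul]
      calc Real.exp (lam * (x + 1)) * (t * max A' 0 * ((N : ℝ) + 1) ^ r * Real.exp (-(x / (2 * Θ'))))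
          = t * max A' 0 * ((N : ℝ) + 1) ^ r * (Real.exp (lam * (x + 1)) * Real.exp (-(x / (2 * Θ')))) := by
            ring
        _ = _ := by rw [ex]; ring
    calc ENNReal.ofReal (Real.exp (lam * (x + 1))) *
          ∫⁻ z, (∫⁻ s in Icc 0 t, ENNReal.ofReal (frac x (Φ.flow s z))) ∂P
        ≤ ENNReal.ofReal (Real.exp (lam * (x + 1))) *
            ENNReal.ofReal (t * max A' 0 * ((N : ℝ) + 1) ^ r * Real.exp (-(x / (2 * Θ')))) :=
          mul_le_mul' le_rfl (h.trans (ENNReal.ofReal_le_ofReal hmono))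
      _ = ENNReal.ofReal (B * ρ ^ j) := by rw [← ENNReal.ofReal_mul (Real.exp_pos _).le, halg]
  -- (d) the Markov–Tonelli step
  have hstep : P {z | t * Cl + 1 < ∫ s in Icc 0 t, ((N + 1 : ℕ) : ℝ)⁻¹ *
      ∑ i, Real.exp (lam * ‖(Φ.flow s z i).2‖ ^ 2)} ≤ ENNReal.ofReal (2 * (t * p * S₁ + B / (1 - ρ))) :=
    partOne_markov_step Φ P hprob hgood0 lam t Cl p B ρ (KN + 1) thr hlam.le ht hCl0 hp0 hB0 hρ0.le hρ1 hthr0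
      hC hbulk' hfar'
  have hsub : {z : Cfg N | t * Cl + 1 < ∫ s in Icc 0 t, ∫ y, Real.exp (lam * ‖y.2‖ ^ 2)
      ∂(empiricalMeasure (Φ.flow s z))} ⊆ {z | t * Cl + 1 < ∫ s in Icc 0 t, ((N + 1 : ℕ) : ℝ)⁻¹ *
      ∑ i, Real.exp (lam * ‖(Φ.flow s z i).2‖ ^ 2)} := by
    intro z hz
    simp only [mem_setOf_eq, integral_empiricalMeasure] at hz ⊢
    exact hz
  have e : 2 * (t * p * S₁ + B / (1 - ρ)) = 2 * (t * (p * S₁) + B / (1 - ρ)) := by ring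
  rw [e] at hstep
  exact (measure_mono hsub).trans hstep

/-! ## The stub -/

/-- STUB 7 `stub_partOne_of_tails` of the line `fibre-deficit-transfer` (PROVED): **for `0 < σ ≤ 1/2`, nice
profiles and `t > 0`, `BulkTailAt ∧ FarTailAt ⇒ PartOneAt`** — sub-Maxwellian one-particle velocity tails at every
level with polynomial probability at each fixed time, plus the far-tail occupation bound in the mean, imply
component (i) of the crux verbatim, with the dialled `λ` of `exists_dial` and the fixed threshold
`C := t·2A⁺e^{λ}/(1 − e^{−(1/(2Θ)−λ)}) + 1`. -/
theorem stub_partOne_of_tails : ∀ (σ : ℝ) (a₀ θ₀ : T3 → ℝ) (u₀ : T3 → V3) (Φ : (N : ℕ) → HardSphereFlow (Torus.geometry (Fin 3)) (hsDiameter σ N) (N + 1)) (t : ℝ), 0 < σ → σ ≤ 1 / 2 → NiceProfiles a₀ θ₀ u₀ → 0 < t → BulkTailAt σ a₀ θ₀ u₀ Φ t → FarTailAt σ a₀ θ₀ u₀ Φ t → PartOneAt σ a₀ θ₀ u₀ Φ t := by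
  intro σ a₀ θ₀ u₀ Φ t _hσ hσ2 hP ht hBulk hFar
  obtain ⟨Θ, A, a, hΘ, ha_pos, N₀, hbulk⟩ := hBulk
  obtain ⟨Θ', A', r, K₀, hΘ', N₀', hfar⟩ := hFar
  obtain ⟨lam, hlam, hδ₁, hδ, hlamK, hq₂⟩ := exists_dial r K₀ hΘ hΘ' ha_pos
  have hAp0' : 0 ≤ max A' 0 := le_max_right _ _
  set δ : ℝ := 1 / (2 * Θ') - lam with hδ_def
  set ρ : ℝ := Real.exp (-δ) with hρ_def
  have hρ1 : ρ < 1 := Real.exp_lt_one_iff.2 (by linarith)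
  have h1ρ : 0 < 1 - ρ := sub_pos.2 hρ1
  set Cl : ℝ := 2 * max A 0 * (Real.exp lam / (1 - Real.exp (-(1 / (2 * Θ) - lam)))) with hCl
  set q₂ : ℝ := δ * a / (2 * lam) - r with hq₂_def
  refine ⟨lam, t * Cl + 1, hlam, ?_⟩
  -- the two error sequences and their decay
  set KN : ℕ → ℕ := fun N => ⌊a / 2 * Real.log ((N : ℝ) + 1) / lam⌋₊ with hKN
  set u : ℕ → ℝ := fun N => ((N : ℝ) + 1) ^ (-a) *
    ∑ K ∈ Finset.range (KN N + 1), Real.exp (lam * ((K : ℝ) + 1)) with hu_def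
  set w : ℕ → ℝ := fun N => t * max A' 0 * ((N : ℝ) + 1) ^ r * Real.exp lam *
    Real.exp (-(δ * ((KN N : ℝ) + 1))) / (1 - ρ) with hw_def
  set c₁ : ℝ := Real.exp (2 * lam) / (Real.exp lam - 1) with hc₁
  set c₂ : ℝ := t * max A' 0 * Real.exp lam / (1 - ρ) with hc₂
  have hc₂0 : 0 ≤ c₂ := by positivity
  have hu : ∀ N, u N ≤ c₁ * ((N : ℝ) + 1) ^ (-(a / 2)) := fun N => slack_mul_sum_le ha_pos hlam N
  have hw : ∀ N, w N ≤ c₂ * ((N : ℝ) + 1) ^ (-q₂) := by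
    intro N
    have h := far_amplitude_le (a := a) r hlam hδ.le hc₂0 N
    have e : w N = c₂ * ((N : ℝ) + 1) ^ r * Real.exp (-(δ * ((KN N : ℝ) + 1))) := by
      rw [hw_def, hc₂]
      ring
    rw [e, hq₂_def]
    exact h
  set bN : ℕ → ℝ := fun N => 2 * (t * (c₁ * ((N : ℝ) + 1) ^ (-(a / 2))) + c₂ * ((N : ℝ) + 1) ^ (-q₂)) with hbN
  have hb : Tendsto bN atTop (𝓝 0) := by
    have h1 := tendsto_rpow_neg_natCast_succ (half_pos ha_pos)
    have h2 := tendsto_rpow_neg_natCast_succ hq₂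
    have h := (((h1.const_mul c₁).const_mul t).add (h2.const_mul c₂)).const_mul 2
    simpa using h
  have hev_half : ∀ᶠ N in atTop, t * u N ≤ 1 / 2 := by
    have h1 : Tendsto (fun N : ℕ => t * (c₁ * ((N : ℝ) + 1) ^ (-(a / 2)))) atTop (𝓝 0) := by
      simpa using ((tendsto_rpow_neg_natCast_succ (half_pos ha_pos)).const_mul c₁).const_mul t
    filter_upwards [(tendsto_order.1 h1).2 (1 / 2) (by norm_num)] with N hN
    exact (mul_le_mul_of_nonneg_left (hu N) ht.le).trans hN.le
  -- the eventual bound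
  have hmain : ∀ᶠ N in atTop, localGibbsLaw σ a₀ u₀ θ₀ N (Φ N)
      {z | t * Cl + 1 < ∫ s in Icc 0 t, ∫ y, Real.exp (lam * ‖y.2‖ ^ 2) ∂(empiricalMeasure ((Φ N).flow s z))} ≤
      ENNReal.ofReal (bN N) := by
    filter_upwards [eventually_ge_atTop N₀, eventually_ge_atTop N₀', eventually_ge_atTop 1, hev_half]
      with N hN hN' hN1 hhalf
    have h : localGibbsLaw σ a₀ u₀ θ₀ N (Φ N) {z | t * Cl + 1 < ∫ s in Icc 0 t, ∫ y, Real.exp (lam * ‖y.2‖ ^ 2)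
        ∂(empiricalMeasure ((Φ N).flow s z))} ≤ ENNReal.ofReal (2 * (t * u N + w N)) :=
      partOne_bound_at hP hσ2 (Φ N) ht hlam hδ₁ hδ hlamK hN1 (hbulk N hN) (hfar N hN') hhalf
    refine h.trans (ENNReal.ofReal_le_ofReal ?_)
    have h1 := mul_le_mul_of_nonneg_left (hu N) ht.le
    have h2 := hw N
    rw [hbN]
    linarith
  -- conclusion
  have hb' : Tendsto (fun N => ENNReal.ofReal (bN N)) atTop (𝓝 0) := by
    have h := ENNReal.tendsto_ofReal hb
    rwa [ENNReal.ofReal_zero] at h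
  exact tendsto_of_tendsto_of_tendsto_of_le_of_le' tendsto_const_nhds hb' (Eventually.of_forall fun N => zero_le)
    hmain

end Summit.AtomisticToContinuum.HydrodynamicLimit.Theorems.FibreDeficitTransfer

end
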